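import Literature.NumberTheory.EllipticCurves.TateModuleGaloisTransportProofs
import Literature.NumberTheory.GaloisRepresentations.ArtinFormalismInductionProofs
import Literature.NumberTheory.EllipticCurves.KummerMap
import HarnessLib

/-!
# Route `CMKolyvaginAtInertTwo`, crux `CMKolyvaginExactAtInertTwo` (stmt-BirchSwinnertonDyer-24277):
# two inputs of the habitat splitting theorem (`InertOrderSplittingHabitat.natCard_stable_eq_sq_of_lift`):
# the torsion-level restriction `ηn` of an endomorphism `η` of `E(k̄)`, and a Galois element without
# non-zero fixed point on `E[2]` over a QUADRATIC extension `L/K` from one over `K`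

Seat `bsd-line-cmk2-p1` g10 (cell `bsd-print-cf2`); helper (`--supports stmt-BirchSwinnertonDyer-24277`).
THEOREMS ONLY: no definition, no named fact, no `sorry`; no item is closed; BSD is not proved by this.
Memo `Cruxes/CMExactDescentAtTwo/MEMO-inert-order-splitting.md` §4; KERNEL-STATUS v9 §9 (b).

* `exists_torsionRestrict` — an additive endomorphism `η` of `E(k̄)` restricts to `E[n]`; if `η` is
  `Γ_k`-equivariant the restriction satisfies the equivariance hypothesis of `resH1Hom (id) ·` VERBATIM
  (the binders `ηn`, `hηn`, `hηnG` of `InertOrderSplittingHabitat.natCard_stable_eq_sq_of_lift`).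
* `exists_fixedPointFree_two_of_finrank_eq_two` — if `z ∈ Γ_K` acts on `E[2]` without non-zero fixed
  point and with `z³ = 1` (a `3`-cycle: `KolyvaginImageTwo.exists_smul_three_of_hasSurjectiveModNGaloisRep`
  for `[K:ℚ] = 2`, `ρ̄₂` onto) and `[L:K] = 2`, then some `g ∈ Γ_L` acts on `E_L[2]` without non-zero
  fixed point: `z² ∈ res(Γ_L)` (index `2`) is again a `3`-cycle (the binder `z` of the habitat theorem
  for `L = K·F`).

References: Gross 1991 §9 (before Prop. 9.1) [GrossLMS1991]; Neukirch, *ANT*, IV §1 [Neukirch1999]; folklore.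
-/

-- single-conjunct summit: `Summit.BirchSwinnertonDyer.BirchSwinnertonDyer.…` repeats the name by design
set_option linter.dupNamespace false
set_option autoImplicit false

noncomputable section

open scoped Classical

namespace Summit.BirchSwinnertonDyer.BirchSwinnertonDyer.Theorems.InertOrderSplittingHabitat

open WeierstrassCurve Field
open Literature.NumberTheory.EllipticCurves
open Literature.NumberTheory.GaloisRepresentations

universe u

/-! ## §1 Restricting `η` to `E[n]` -/

/-- **The restriction of `η` to `E[n]`**, with the equivariance hypothesis of `resH1Hom id` when `η`
is `Γ_k`-equivariant. [folklore] -/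
theorem exists_torsionRestrict {k : Type u} [Field k] (V : WeierstrassCurve k)
    (η : AddMonoid.End (geomPoints V))
    (hη : ∀ (γ : absoluteGaloisGroup k) (P : geomPoints V), γ • η P = η (γ • P)) (n : ℤ) :
    ∃ ηn : geomTorsion V n →+ geomTorsion V n,
      (∀ P : geomTorsion V n, (ηn P : geomPoints V) = η P) ∧
      (∀ (x : absoluteGaloisGroup k) (P : geomTorsion V n),
        ηn (ContinuousMonoidHom.id (absoluteGaloisGroup k) x • P) = x • ηn P) := by
  refine ⟨(η.comp (geomTorsion V n).subtype).codRestrict (geomTorsion V n) fun P ↦ ?_,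
    fun P ↦ rfl, fun x P ↦ Subtype.ext ?_⟩
  · rw [mem_geomTorsion_iff, AddMonoidHom.coe_comp, AddSubgroup.coe_subtype, Function.comp_apply,
      ← map_zsmul, (mem_geomTorsion_iff V n _).mp P.2, map_zero]
  · simp only [AddMonoidHom.codRestrict_apply, AddMonoidHom.coe_comp, AddSubgroup.coe_subtype,
      Function.comp_apply, AddSubgroup.torsionBy.coe_smul]
    exact (hη x P).symm

/-! ## §2 A fixed-point-free element over a quadratic extension -/

/-- **A `3`-cycle on `E[2]` over `K` gives one over every quadratic extension `L/K`**: if `z ∈ Γ_K`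
acts on `E[2]` without non-zero fixed point and `z³ = 1` there, and `[L : K] = 2`, then some
`g ∈ Γ_L` acts on `E_L[2]` without non-zero fixed point — `z² ∈ res(Γ_L)` (a subgroup of index `2`),
and `z²` is the inverse `3`-cycle. (`E(K̄) ≃ E_L(L̄)` equivariantly along `res`:
`WeierstrassCurve.exists_addEquiv_geomPoints_baseChange`.) [cite: GrossLMS1991, §9 (before Prop. 9.1)] -/
theorem exists_fixedPointFree_two_of_finrank_eq_two {K : Type u} [Field K] [CharZero K]
    (V : WeierstrassCurve K) (L : Type u) [Field L] [Algebra K L] [FiniteDimensional K L]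
    (hL : Module.finrank K L = 2) {z : absoluteGaloisGroup K}
    (hz3 : ∀ P : geomPoints V, (2 : ℤ) • P = 0 → z • z • z • P = P)
    (hz : ∀ P : geomPoints V, (2 : ℤ) • P = 0 → z • P = P → P = 0) :
    ∃ g : absoluteGaloisGroup L,
      ∀ P : geomPoints (V.baseChange L), (2 : ℤ) • P = 0 → g • P = P → P = 0 := by
  haveI : Algebra.IsAlgebraic K L := Algebra.IsAlgebraic.of_finite K L
  obtain ⟨e, he⟩ := WeierstrassCurve.exists_addEquiv_geomPoints_baseChange V L
  -- `z² ∈ res(Γ_L)`, a subgroup of index `2`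
  set H := (absGaloisRestrict K L).range with hH
  have hHi : H.index = 2 := (index_range_absGaloisRestrict_eq_finrank K L).trans hL
  haveI : H.Normal := Subgroup.normal_of_index_eq_two hHi
  haveI : H.FiniteIndex := ⟨by rw [hHi]; decide⟩
  obtain ⟨g, hg⟩ : z ^ 2 ∈ H := by
    have := Subgroup.pow_index_mem H z
    rwa [hHi] at this
  refine ⟨g, fun P' h2 hfix ↦ ?_⟩
  obtain ⟨P, rfl⟩ := e.surjective P'
  have h2P : (2 : ℤ) • P = 0 := e.injective (by rw [map_zsmul, h2, map_zero])
  have hg' : (absGaloisRestrict K L) g = z ^ 2 := hg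
  -- `g • eP = e(z² P)`, so `z² P = P`, whence `zP = z³P = P` and `P = 0`
  have hzz : z • z • P = P := by
    apply e.injective
    rw [← mul_smul, ← pow_two, ← hg', he, hfix]
  have hzP : z • P = P := by
    have h3 := hz3 P h2P
    rw [hzz] at h3
    exact h3
  rw [hz P h2P hzP, map_zero]

end Summit.BirchSwinnertonDyer.BirchSwinnertonDyer.Theorems.InertOrderSplittingHabitat
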